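import Literature.Geometry.Lorentzian.NullFocusing
import Literature.Geometry.Lorentzian.TrappedSurface
import Literature.Geometry.Lorentzian.MetricNormSq
import Literature.Geometry.Lorentzian.Einstein
import Literature.Geometry.Riemannian.ExpMapGlobalSmooth
import HarnessLib

/-!
# The null focusing theorem in a four-dimensional spacetime: the `nullExpansion` form

The null focusing theorem `exists_not_injective_mfderiv_normalExp_of_nullExpansion_neg`
(`NullFocusing.lean`; O'Neill 1983, Ch. 10, Props. 30, 43; Hawking–Ellis 1973, §4.4,
Prop. 4.4.6) specialised to the vocabulary of the tree's trapped-surface files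
(`TrappedSurface.lean`, `PenroseSingularityTheoremProofs.lean`, `EventHorizonArea.lean`): a smooth
spacetime `𝓢 : Spacetime 4`, a spacelike immersion `f : T → M` of a `2`-manifold
(`IsSpacelikeImmersion`), a `C^∞` null normal field `L` along `f`, the **null expansion**
`θ_L = tr_{f^* g} χ_L` of `LorentzianMetric.nullExpansion`, and the null convergence condition
`SatisfiesNullConvergence`:

* `Spacetime.exists_focalPoint_of_nullExpansion_neg`: if `θ_L(z) < 0` and the null normal
  geodesic `t ↦ exp_{f z}(t L z)` is defined on `[0, 2/|θ_L(z)|]`, then the normal exponential map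
  `(y, t) ↦ exp_{f y}(t L y)` has non-injective differential at `(z, t)` for some
  `t ∈ (0, 2/|θ_L(z)|]` — Hawking–Ellis 1973, Prop. 4.4.6: "there will be a point conjugate to
  the surface along `γ(s)` within an affine distance `2/(-θ̂)`"; this is the focusing input of
  Chruściel–Delay–Galloway–Howard 2001, Prop. 4.17, and of the Penrose singularity theorem.

The bridge consists of: the `C^∞` and `C¹` regularity of the Levi-Civita connection of the smooth
metric (`isLocallyContMDiff_leviCivita_holds`), an `f^* g`-orthonormal basis of `T_zT`
(`exists_isOrthoᵢ_basis`, normalised by positivity of the induced form), the frame formula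
`tr_{f^*g} χ = ∑ᵢ χ(wᵢ, wᵢ)` (`repr_eq_div_of_isOrthoᵢ`) with `χ(v, w) = g(D_v L, df w)`
(`secondFundamentalForm_apply_holds`), and the null convergence condition along the null geodesic
(whose velocity stays null and nonzero). No definitions, no named facts (D-0026).

## References

* S. W. Hawking, G. F. R. Ellis, *The large scale structure of space-time*, CUP 1973, §4.4,
  Prop. 4.4.6.
* B. O'Neill, *Semi-Riemannian geometry with applications to relativity* (1983), Ch. 10,
  Props. 30, 43.
* P. T. Chruściel, E. Delay, G. J. Galloway, R. Howard, Ann. Henri Poincaré 2 (2001), Prop. 4.17.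
-/

noncomputable section

open Bundle Set Filter Function Module
open scoped Manifold ContDiff Topology

namespace Literature.Geometry.Lorentzian

open Literature.Geometry.Riemannian

universe u

/-- **The null focusing theorem in a smooth four-dimensional spacetime** (Hawking–Ellis 1973,
Prop. 4.4.6; O'Neill 1983, Ch. 10, Prop. 43 with Prop. 30 (3)). Let `f : T → M` be a spacelike
immersion of a `2`-manifold into the smooth spacetime `𝓢`, `L` a `C^∞` field along `f` which is
null and normal to `f`, and suppose the null convergence condition `Ric(v, v) ≥ 0` for null `v`.
If at `z ∈ T` the null expansion `θ = θ_L(z) = tr_{f^*g} χ_L` (`LorentzianMetric.nullExpansion`) is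
negative and the null normal geodesic `t ↦ exp_{f z}(t L z)` is defined on `[0, 2/(-θ)]`, then for
some `t ∈ (0, 2/(-θ)]` the differential at `(z, t)` of the normal exponential map
`(y, s) ↦ exp_{f y}(s L y)` is not injective: `f(T)` has a focal point along the geodesic within
affine distance `2/(-θ)`. [cite: HawkingEllis1973CUP, §4.4, Prop. 4.4.6]
[cite: ONeillSemiRiemannian1983, Ch. 10, Prop. 43 and Prop. 30] [cite: ChruscielEtAl2001, Prop. 4.17] -/
theorem Spacetime.exists_focalPoint_of_nullExpansion_neg (𝓢 : Spacetime.{u} 4)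
    [𝓢.metric.HasLeviCivita] {T : Type*} [TopologicalSpace T]
    [ChartedSpace (EuclideanSpace ℝ (Fin 2)) T] [IsManifold (𝓡 2) ∞ T] {f : T → 𝓢.carrier}
    (hpb : PseudoRiemannianMetric.contMDiff_pullbackBilin (𝓡 4) 𝓢.carrier (𝓡 2) T ∞)
    (hf : 𝓢.metric.IsSpacelikeImmersion (𝓡 2) f) {L : Π y : T, TangentSpace (𝓡 4) (f y)}
    (hL : ContMDiff (𝓡 2) (𝓡 4).tangent ∞
      (fun y ↦ (TotalSpace.mk' E4 (f y) (L y) : TangentBundle (𝓡 4) 𝓢.carrier)))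
    (hLnull : ∀ y, 𝓢.metric.IsNull (L y)) (hLn : 𝓢.metric.IsNormalTo (𝓡 2) f L)
    (hNEC : 𝓢.metric.SatisfiesNullConvergence) {z : T}
    (hθ : 𝓢.metric.nullExpansion f hpb hf L z < 0)
    (hdom : Icc 0 (2 / (-𝓢.metric.nullExpansion f hpb hf L z)) ⊆
      maximalGeodesicDomain 𝓢.metric.leviCivita (f z) (L z)) :
    ∃ t ∈ Ioc 0 (2 / (-𝓢.metric.nullExpansion f hpb hf L z)),
      ¬ Injective (mfderiv ((𝓡 2).prod 𝓘(ℝ, ℝ)) (𝓡 4)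
        (fun q : T × ℝ ↦ expMap 𝓢.metric.leviCivita (f q.1) (q.2 • L q.1)) (z, t)) := by
  classical
  -- regularity of the Levi-Civita connection of the smooth metric
  have hk1 : (((1 : ℕ∞) : ℕ∞ω)) + 1 ≤ ∞ := by exact_mod_cast le_top
  have hkT : (((⊤ : ℕ∞) : ℕ∞ω)) + 1 ≤ ∞ := by exact_mod_cast le_top
  have hreg₁ : 𝓢.metric.leviCivita.IsLocallyContMDiff 1 :=
    𝓢.metric.isLocallyContMDiff_leviCivita_holds 1 hk1
  have hreg : 𝓢.metric.leviCivita.IsLocallyContMDiff ∞ :=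
    𝓢.metric.isLocallyContMDiff_leviCivita_holds ⊤ hkT
  haveI : CovariantDerivative.ContMDiffCovariantDerivative 𝓢.metric.leviCivita 1 :=
    ⟨hreg₁ univ isOpen_univ⟩
  haveI : CovariantDerivative.ContMDiffCovariantDerivative 𝓢.metric.leviCivita (⊤ : ℕ∞) :=
    ⟨hreg univ isOpen_univ⟩
  have hn : (2 : ℕ∞ω) ≤ ∞ := WithTop.coe_le_coe.2 le_top
  -- an `f^* g`-orthonormal basis of `T_zT`
  obtain ⟨e, he, hene⟩ := (𝓢.metric.inducedMetric f hpb hf).exists_isOrthoᵢ_basis z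
  have hfin : finrank ℝ (TangentSpace (𝓡 2) z) = 2 := finrank_euclideanSpace_fin
  have hcardι : Fintype.card (Fin (finrank ℝ (TangentSpace (𝓡 2) z))) = 2 := by
    rw [Fintype.card_fin, hfin]
  have hval : ∀ v v' : TangentSpace (𝓡 2) z, (𝓢.metric.inducedMetric f hpb hf).val z v v' =
      𝓢.metric.val (f z) (mfderiv (𝓡 2) (𝓡 4) f z v) (mfderiv (𝓡 2) (𝓡 4) f z v') :=
    fun v v' ↦ rfl
  have hepos : ∀ i, 0 < (𝓢.metric.inducedMetric f hpb hf).val z (e i) (e i) := fun i ↦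
    hf.inducedBilin_pos z (e.ne_zero i)
  set r : Fin (finrank ℝ (TangentSpace (𝓡 2) z)) → ℝ :=
    fun i ↦ (Real.sqrt ((𝓢.metric.inducedMetric f hpb hf).val z (e i) (e i)))⁻¹ with hr
  have hrr : ∀ i, r i * r i = ((𝓢.metric.inducedMetric f hpb hf).val z (e i) (e i))⁻¹ := fun i ↦ by
    rw [hr, ← mul_inv, Real.mul_self_sqrt (hepos i).le]
  set w : Fin (finrank ℝ (TangentSpace (𝓡 2) z)) → TangentSpace (𝓡 2) z := fun i ↦ r i • e i
    with hw
  have hgTw : ∀ i j, (𝓢.metric.inducedMetric f hpb hf).val z (w i) (w j) =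
      if i = j then 1 else 0 := by
    intro i j
    simp only [hw, map_smul, smul_eq_mul, FunLike.coe_smul, Pi.smul_apply]
    by_cases hij : i = j
    · subst hij
      rw [if_pos rfl, ← mul_assoc, hrr, inv_mul_cancel₀ (hene i)]
    · rw [if_neg hij]
      have h : (𝓢.metric.inducedMetric f hpb hf).val z (e i) (e j) = 0 :=
        LinearMap.isOrthoᵢ_def.1 he i j hij
      rw [h, mul_zero, mul_zero]
  have hw' : ∀ i j, 𝓢.metric.val (f z) (mfderiv (𝓡 2) (𝓡 4) f z (w i))
      (mfderiv (𝓡 2) (𝓡 4) f z (w j)) = if i = j then 1 else 0 := fun i j ↦ by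
    rw [← hval]; exact hgTw i j
  -- the null expansion is the frame sum `∑ᵢ χ(wᵢ, wᵢ)`
  have happ : ∀ v v' : TangentSpace (𝓡 2) z,
      𝓢.metric.secondFundamentalForm (𝓡 2) f L z v v' =
      𝓢.metric.val (f z) (𝓢.metric.normalDerivAlong f L z v) (mfderiv (𝓡 2) (𝓡 4) f z v') :=
    fun v v' ↦ PseudoRiemannianMetric.secondFundamentalForm_apply_holds
      (g := 𝓢.metric.toPseudoRiemannianMetric) (I' := 𝓡 2) (y := z)
      BoundarylessManifold.isInteriorPoint ((hL z).mdifferentiableAt (by simp)) v v'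
  have hθsum : ∑ i, 𝓢.metric.val (f z) (𝓢.metric.normalDerivAlong f L z (w i))
      (mfderiv (𝓡 2) (𝓡 4) f z (w i)) = 𝓢.metric.nullExpansion f hpb hf L z := by
    have htr : 𝓢.metric.nullExpansion f hpb hf L z =
        ∑ i, 𝓢.metric.secondFundamentalForm (𝓡 2) f L z (e i) (e i) /
          (𝓢.metric.inducedMetric f hpb hf).val z (e i) (e i) := by
      show (𝓢.metric.inducedMetric f hpb hf).trace z (𝓢.metric.secondFundamentalForm (𝓡 2) f L z) = _
      rw [PseudoRiemannianMetric.trace, LinearMap.trace_eq_matrix_trace ℝ e, Matrix.trace]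
      refine Finset.sum_congr rfl fun i _ ↦ ?_
      rw [Matrix.diag_apply, LinearMap.toMatrix_apply,
        repr_eq_div_of_isOrthoᵢ e he (fun i ↦ hene i), LinearMap.comp_apply]
      simp only [PseudoRiemannianMetric.toBilinForm_apply, LinearEquiv.coe_coe,
        PseudoRiemannianMetric.val_sharp_apply]
    rw [htr]
    refine Finset.sum_congr rfl fun i _ ↦ ?_
    rw [← happ]
    simp only [hw, map_smul, LinearMap.smul_apply, smul_eq_mul]
    rw [← mul_assoc, hrr i, div_eq_inv_mul]
  -- the null convergence condition along the null normal geodesic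
  obtain ⟨hmax, h0, -, -⟩ := maximalGeodesic_spec' (cov := 𝓢.metric.leviCivita) (f z) (L z)
  have hgeo := isGeodesicOn_expMap_smul (cov := 𝓢.metric.leviCivita) (f z) (L z)
  have hv0 : velocity (𝓡 4) (fun t : ℝ ↦ expMap 𝓢.metric.leviCivita (f z) (t • L z)) 0 = L z :=
    velocity_expMap_smul_zero (cov := 𝓢.metric.leviCivita) (f z) (L z)
  have hγ0 : expMap 𝓢.metric.leviCivita (f z) ((0 : ℝ) • L z) = f z := by
    rw [zero_smul]
    exact expMap_zero (cov := 𝓢.metric.leviCivita) (f z)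
  have hNEC' : ∀ t ∈ maximalGeodesicDomain 𝓢.metric.leviCivita (f z) (L z), 0 ≤ t →
      0 ≤ 𝓢.metric.leviCivita.ricci (expMap 𝓢.metric.leviCivita (f z) (t • L z))
        (velocity (𝓡 4) (fun t : ℝ ↦ expMap 𝓢.metric.leviCivita (f z) (t • L z)) t)
        (velocity (𝓡 4) (fun t : ℝ ↦ expMap 𝓢.metric.leviCivita (f z) (t • L z)) t) := by
    intro t ht _
    refine hNEC _ _ ⟨?_, ?_⟩
    · have h := 𝓢.metric.toPseudoRiemannianMetric.val_velocity_eq_of_isGeodesicOn_holds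
        hmax.isOpen hmax.2.1 hgeo ht h0
      rw [hv0, hγ0] at h
      rw [h]
      exact (hLnull z).1
    · exact IsGeodesicOn.velocity_ne_zero (cov := 𝓢.metric.leviCivita) hmax.isOpen hmax.2.1
        hgeo h0 (by rw [hv0]; exact (hLnull z).2) ht
  -- the abstract focusing theorem
  have hE4 : finrank ℝ E4 = 4 := finrank_euclideanSpace_fin
  have hcard : Fintype.card (Fin (finrank ℝ (TangentSpace (𝓡 2) z))) + 2 = finrank ℝ E4 := by
    rw [hcardι, hE4]
  haveI : Nonempty (Fin (finrank ℝ (TangentSpace (𝓡 2) z))) :=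
    Fintype.card_pos_iff.1 (by rw [hcardι]; norm_num)
  have hdom' : Icc 0 (Fintype.card (Fin (finrank ℝ (TangentSpace (𝓡 2) z))) /
      (-𝓢.metric.nullExpansion f hpb hf L z)) ⊆
      maximalGeodesicDomain 𝓢.metric.leviCivita (f z) (L z) := by
    rw [hcardι]; exact_mod_cast hdom
  obtain ⟨t, ht, hnot⟩ := exists_not_injective_mfderiv_normalExp_of_nullExpansion_neg 𝓢.metric
    hreg hreg₁ hn hL (fun y ↦ (hLnull y).1) (fun y ↦ (hLnull y).2) hLn hcard w hw' hθsum hθ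
    hNEC' hdom'
  refine ⟨t, ?_, hnot⟩
  rw [hcardι] at ht
  exact_mod_cast ht

end Literature.Geometry.Lorentzian

end
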